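import Mathlib
import Summits.CriticalPhenomena.CardyFormulaZ2.Theorems.CardySelfRefinementDefs
import Summits.CriticalPhenomena.CardyFormulaZ2.Theorems.CardySelfRefinementTrivialSectorRateStubSixArmDecayReduction
import Literature.Probability.Percolation.FourArmGarbanShift
import Literature.Probability.Percolation.ZdFourArmFromFiveArm
import Literature.Probability.Percolation.SelfRefinementMeasure
import HarnessLib

/-!
# Stub `stub_sixArmDecay` of line `far-field-is-a-quarter-turn` (crux `TrivialSectorRate`,
stmt-CriticalPhenomena-10266): CENTRES — the `kℤ²`-translation invariance of `M_k` reduces the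
uniformity in the centre of the two arm inputs (S5), (S6) to the `k²` residue centres

The reduction `sixArmDecayAlong_of_fiveArm` (`…StubSixArmDecayReduction.lean`) asks for the five-arm
upper bound (S5) and the sixth-arm price (S6) for the self-refinement law `M_k(γ s)` UNIFORMLY in the
centre `c ∈ ℤ²` (the five-arm event recentred by `BondConfig.relabel (sym2Equiv (Site.shift (-c)))`,
the six-arm event `sixArmThreeClustersAt c m n`).  Unlike `P_p`, the dependent model `M_k(ρ,c)` is
NOT invariant under all translations of `ℤ²` — only under those of the coarse lattice `kℤ²`
(`selfRefinementMeasure_map_relabel_shift`: translating by `k a` maps bundles to bundles).  This file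
proves that this is enough to remove the centre from (S5), (S6):

* `relabel_shift_relabel_shift`, `preimage_relabel_shift_neg_add` — composition of translations of
  configurations;
* `M_real_preimage_relabel_shift_smul`, `M_real_preimage_relabel_shift_neg_add_ctr` — for `k ≠ 0`,
  `M_k(ρ,c₀){ω | ω - (c + k v) ∈ E} = M_k(ρ,c₀){ω | ω - c ∈ E}`: recentred events have a probability
  depending only on the residue of the centre mod `k`; in particular for the six-arm, four-arm and
  five-arm events (`M_real_sixArmThreeClustersAt_add_ctr`, `M_real_fourArmTwoClustersAt_add_ctr`,
  `M_real_preimage_zdFiveArmClusters_add_ctr`);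
* `exists_eq_residue_add_ctr` — every centre is a residue centre `c₀ ∈ [0,k)²` plus a coarse vector;
* `uniform_of_residues` — bookkeeping: a bound `f ≤ C g` with `kℤ²`-invariant `f`, `g ≥ 0`, proved at
  each of the finitely many residue centres with its own constant and threshold, holds uniformly in
  the centre (sum of the constants, sum of the thresholds);
* **`sixArmDecayAlong_of_fiveArm_residues`** (registered helper of the stub): (S5) and (S6) stated at
  the `k²` residue centres only, uniformly in `s`, already give `SixArmDecayAlong k γ`;
* `M_real_exists_ctr_shift_mem_le_card_mul` — the union bound over a finite set of COARSE centres,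
  `M_k(∃ v ∈ B, ω - k v ∈ E) ≤ |B| · M_k(E)` (the counting step of the five-arm construction,
  `real_exists_shift_mem_le_card_mul` of `ZdFiveArmCounting.lean`, for `M_k`);
* `card_mul_le_one_of_pairwiseDisjoint` — the counting step of the five-arm UPPER bound
  (Kesten–Sidoravicius–Zhang; Nolin 2008 Thm. 23 (ii): "at most one site can be a five-arm site"):
  pairwise disjoint events of probability `≥ p` at `|B|` sites force `|B| · p ≤ 1`, for any
  probability measure.

* `uniform_of_residues_ratio`, **`sixArmDecayAlong_of_residues_large_scales`** (registered helper) —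
  the same with a residue-dependent ratio threshold `n ≥ A m`: a six-arm bound `C (m/n)^{2+ε}` at
  the `k²` residue centres for large scales and large ratios already gives `SixArmDecayAlong k γ`
  (with `sixArmDecayAlong_of_large_scales`).

Target file:
`Summits/CriticalPhenomena/CardyFormulaZ2/Theorems/CardySelfRefinementTrivialSectorRateStubSixArmDecayCentres.lean`.
-/

noncomputable section


namespace Summit.CriticalPhenomena.CardyFormulaZ2.Theorems.CardySelfRefinement.FarField

open Set MeasureTheory
open Literature.Probability.LatticeModels Literature.Probability.Percolation
open Literature.Probability.Percolation.QuadCrossing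
open Summit.CriticalPhenomena.CardyFormulaZ2.Theses.CardySelfRefinement

/-! ### Translations of configurations compose -/

-- adapted from Literature/Probability/Percolation/LatticeTraceGeometry.lean (`relabel_shift_neg_relabel_shift`)
/-- Translating a configuration by `a` and then by `b` is translating it by `a + b`. -/
theorem relabel_shift_relabel_shift (a b : Site 2) (ω : BondConfig (Site 2)) :
    BondConfig.relabel (sym2Equiv (Site.shift b)) (BondConfig.relabel (sym2Equiv (Site.shift a)) ω) =
      BondConfig.relabel (sym2Equiv (Site.shift (a + b))) ω := by
  rw [BondConfig.relabel_apply, BondConfig.relabel_apply, BondConfig.relabel_apply, image_image]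
  refine congrArg (fun f : Sym2 (Site 2) → Sym2 (Site 2) => f '' ω) (funext fun z => ?_)
  induction z using Sym2.ind with
  | h x y => simp [Site.shift_apply, add_assoc]

/-- Recentring at `c + w` is recentring at `w`, then at `c`:
`{ω | ω - (c + w) ∈ E} = {ω | ω - w ∈ {ω' | ω' - c ∈ E}}`. -/
theorem preimage_relabel_shift_neg_add (c w : Site 2) (E : Set (BondConfig (Site 2))) :
    BondConfig.relabel (sym2Equiv (Site.shift (-(c + w)))) ⁻¹' E =
      BondConfig.relabel (sym2Equiv (Site.shift (-w))) ⁻¹'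
        (BondConfig.relabel (sym2Equiv (Site.shift (-c))) ⁻¹' E) := by
  ext ω
  simp only [mem_preimage]
  rw [relabel_shift_relabel_shift, show -w + -c = -(c + w) by abel]

/-! ### `kℤ²`-translation invariance of `M_k` -/

/-- The coarse vertex `u` in fine coordinates is `k • u`. -/
theorem ctr_eq_smul (k : ℕ) (u : Site 2) : ctr k u = (k : ℤ) • u := by
  funext i
  simp [ctr, Pi.smul_apply]

/-- **`M_k(ρ,c₀)` is invariant under the translations of `kℤ²`** (`k ≠ 0`): applied form
`M_k {ω | ω + k a ∈ E} = M_k(E)` of `selfRefinementMeasure_map_relabel_shift` (the route's `M k ρ c₀`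
is, term for term, the tree's `selfRefinementMeasure k ρ c₀`). -/
theorem M_real_preimage_relabel_shift_smul {k : ℕ} (hk : k ≠ 0) (ρ c₀ : ℝ) (a : Site 2)
    (E : Set (BondConfig (Site 2))) :
    (M k ρ c₀).real (BondConfig.relabel (sym2Equiv (Site.shift ((k : ℤ) • a))) ⁻¹' E) =
      (M k ρ c₀).real E :=
  selfRefinementMeasure_real_preimage_relabel_shift hk ρ c₀ a E

/-- **Recentred events have an `M_k`-probability depending only on the centre mod `k`**:
`M_k(ρ,c₀){ω | ω - (c + k v) ∈ E} = M_k(ρ,c₀){ω | ω - c ∈ E}`. -/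
theorem M_real_preimage_relabel_shift_neg_add_ctr {k : ℕ} (hk : k ≠ 0) (ρ c₀ : ℝ) (c v : Site 2)
    (E : Set (BondConfig (Site 2))) :
    (M k ρ c₀).real (BondConfig.relabel (sym2Equiv (Site.shift (-(c + ctr k v)))) ⁻¹' E) =
      (M k ρ c₀).real (BondConfig.relabel (sym2Equiv (Site.shift (-c))) ⁻¹' E) := by
  rw [preimage_relabel_shift_neg_add, ctr_eq_smul, ← smul_neg]
  exact M_real_preimage_relabel_shift_smul hk ρ c₀ (-v) _

/-- The six-arm probability around `c + k v` is that around `c`. -/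
theorem M_real_sixArmThreeClustersAt_add_ctr {k : ℕ} (hk : k ≠ 0) (ρ c₀ : ℝ) (c v : Site 2)
    (m n : ℕ) :
    (M k ρ c₀).real (sixArmThreeClustersAt (c + ctr k v) m n) =
      (M k ρ c₀).real (sixArmThreeClustersAt c m n) := by
  rw [sixArmThreeClustersAt_eq_preimage, sixArmThreeClustersAt_eq_preimage c]
  exact M_real_preimage_relabel_shift_neg_add_ctr hk ρ c₀ c v _

/-- The four-arm probability around `c + k v` is that around `c`. -/
theorem M_real_fourArmTwoClustersAt_add_ctr {k : ℕ} (hk : k ≠ 0) (ρ c₀ : ℝ) (c v : Site 2)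
    (m n : ℕ) :
    (M k ρ c₀).real (fourArmTwoClustersAt (c + ctr k v) m n) =
      (M k ρ c₀).real (fourArmTwoClustersAt c m n) := by
  rw [fourArmTwoClustersAt_eq_preimage, fourArmTwoClustersAt_eq_preimage c]
  exact M_real_preimage_relabel_shift_neg_add_ctr hk ρ c₀ c v _

/-- The recentred five-arm probability (the event of (S5)) around `c + k v` is that around `c`. -/
theorem M_real_preimage_zdFiveArmClusters_add_ctr {k : ℕ} (hk : k ≠ 0) (ρ c₀ : ℝ) (c v : Site 2)
    (m n : ℕ) :
    (M k ρ c₀).real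
        (BondConfig.relabel (sym2Equiv (Site.shift (-(c + ctr k v)))) ⁻¹' zdFiveArmClusters m n) =
      (M k ρ c₀).real
        (BondConfig.relabel (sym2Equiv (Site.shift (-c))) ⁻¹' zdFiveArmClusters m n) :=
  M_real_preimage_relabel_shift_neg_add_ctr hk ρ c₀ c v _

/-! ### Residue centres -/

/-- **Every centre is a residue centre plus a coarse vector**: `c = c₀ + k v` with `c₀ ∈ [0,k)²`
(`c₀ = c mod k`, `v = c div k`, coordinatewise). -/
theorem exists_eq_residue_add_ctr {k : ℕ} (hk : 0 < k) (c : Site 2) :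
    ∃ c₀ v : Site 2, (∀ i, 0 ≤ c₀ i ∧ c₀ i < k) ∧ c = c₀ + ctr k v := by
  have hk' : (0 : ℤ) < k := by exact_mod_cast hk
  refine ⟨fun i => c i % (k : ℤ), fun i => c i / (k : ℤ), fun i => ⟨Int.emod_nonneg _ hk'.ne',
    Int.emod_lt_of_pos _ hk'⟩, funext fun i => ?_⟩
  simp only [Pi.add_apply, ctr]
  exact (Int.emod_add_mul_ediv (c i) k).symm

/-- The finite set of residue centres `[0,k)² ⊆ ℤ²`. -/
theorem mem_residues_iff (k : ℕ) (c₀ : Site 2) :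
    c₀ ∈ Fintype.piFinset (fun _ : Fin 2 => Finset.Ico (0 : ℤ) k) ↔ ∀ i, 0 ≤ c₀ i ∧ c₀ i < k := by
  simp only [Fintype.mem_piFinset, Finset.mem_Ico]

/-- **Bookkeeping: centre-uniform bounds from bounds at the residue centres.**  Let `f s c m n` and
`g s c m n ≥ 0` be invariant under `c ↦ c + k v` (`k > 0`).  If at every residue centre
`c₀ ∈ [0,k)²` there are `C`, `m₀` with `f s c₀ m n ≤ C · g s c₀ m n` for all `s` and `m₀ ≤ m ≤ n`,
then one constant and one threshold serve all centres (the sums over the `k²` residues of the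
positive parts of the constants and of the thresholds). -/
theorem uniform_of_residues {k : ℕ} (hk : 0 < k) (f g : unitInterval → Site 2 → ℕ → ℕ → ℝ)
    (hf : ∀ s c v m n, f s (c + ctr k v) m n = f s c m n)
    (hg : ∀ s c v m n, g s (c + ctr k v) m n = g s c m n) (hg0 : ∀ s c m n, 0 ≤ g s c m n)
    (h : ∀ c₀ : Site 2, (∀ i, 0 ≤ c₀ i ∧ c₀ i < k) → ∃ C : ℝ, ∃ m₀ : ℕ,
      ∀ (s : unitInterval) (m n : ℕ), m₀ ≤ m → m ≤ n → f s c₀ m n ≤ C * g s c₀ m n) :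
    ∃ C : ℝ, ∃ m₀ : ℕ, ∀ (s : unitInterval) (c : Site 2) (m n : ℕ), m₀ ≤ m → m ≤ n →
      f s c m n ≤ C * g s c m n := by
  classical
  -- constants and thresholds at every centre (junk `0` off the residues)
  have h' : ∀ c₀ : Site 2, ∃ C : ℝ, ∃ m₀ : ℕ, (∀ i, 0 ≤ c₀ i ∧ c₀ i < k) →
      ∀ (s : unitInterval) (m n : ℕ), m₀ ≤ m → m ≤ n → f s c₀ m n ≤ C * g s c₀ m n := by
    intro c₀
    by_cases hc₀ : ∀ i, 0 ≤ c₀ i ∧ c₀ i < k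
    · obtain ⟨C, m₀, hC⟩ := h c₀ hc₀
      exact ⟨C, m₀, fun _ => hC⟩
    · exact ⟨0, 0, fun h'' => absurd h'' hc₀⟩
  choose C m₀ hC using h'
  set R : Finset (Site 2) := Fintype.piFinset (fun _ : Fin 2 => Finset.Ico (0 : ℤ) k) with hR
  refine ⟨∑ c₀ ∈ R, max (C c₀) 0, ∑ c₀ ∈ R, m₀ c₀, fun s c m n hm hmn => ?_⟩
  obtain ⟨c₀, v, hc₀, rfl⟩ := exists_eq_residue_add_ctr hk c
  have hc₀R : c₀ ∈ R := (mem_residues_iff k c₀).2 hc₀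
  rw [hf, hg]
  have hm₀ : m₀ c₀ ≤ m := le_trans (Finset.single_le_sum (fun _ _ => Nat.zero_le _) hc₀R) hm
  have hCle : max (C c₀) 0 ≤ ∑ c₁ ∈ R, max (C c₁) 0 :=
    Finset.single_le_sum (f := fun c₁ => max (C c₁) 0) (fun _ _ => le_max_right _ _) hc₀R
  calc f s c₀ m n ≤ C c₀ * g s c₀ m n := hC c₀ hc₀ s m n hm₀ hmn
    _ ≤ max (C c₀) 0 * g s c₀ m n := mul_le_mul_of_nonneg_right (le_max_left _ _) (hg0 s c₀ m n)
    _ ≤ (∑ c₁ ∈ R, max (C c₁) 0) * g s c₀ m n := mul_le_mul_of_nonneg_right hCle (hg0 s c₀ m n)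

/-! ### (S5), (S6) at the residue centres suffice -/

/-- **(S5) at the residue centres gives (S5) at every centre**: if for each `c₀ ∈ [0,k)²` the
recentred five-arm probability of `M_k(γ s)` is `≤ C₅(c₀) (m/n)²` for `m₀(c₀) ≤ m ≤ n`, uniformly in
`s`, then one `C₅`, `m₀` serve all centres `c ∈ ℤ²`. -/
theorem fiveArm_bound_of_residues {k : ℕ} (hk : 0 < k) (γ : unitInterval → ℝ × ℝ)
    (h₅ : ∀ c₀ : Site 2, (∀ i, 0 ≤ c₀ i ∧ c₀ i < k) → ∃ C₅ : ℝ, ∃ m₀ : ℕ,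
      ∀ (s : unitInterval) (m n : ℕ), m₀ ≤ m → m ≤ n →
        (M k (γ s).1 (γ s).2).real
            (BondConfig.relabel (sym2Equiv (Site.shift (-c₀))) ⁻¹' zdFiveArmClusters m n) ≤
          C₅ * ((m : ℝ) / n) ^ 2) :
    ∃ C₅ : ℝ, ∃ m₀ : ℕ, ∀ (s : unitInterval) (c : Site 2) (m n : ℕ), m₀ ≤ m → m ≤ n →
      (M k (γ s).1 (γ s).2).real
          (BondConfig.relabel (sym2Equiv (Site.shift (-c))) ⁻¹' zdFiveArmClusters m n) ≤
        C₅ * ((m : ℝ) / n) ^ 2 :=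
  uniform_of_residues hk
    (fun s c m n => (M k (γ s).1 (γ s).2).real
      (BondConfig.relabel (sym2Equiv (Site.shift (-c))) ⁻¹' zdFiveArmClusters m n))
    (fun _ _ m n => ((m : ℝ) / n) ^ 2)
    (fun s c v m n => M_real_preimage_zdFiveArmClusters_add_ctr hk.ne' _ _ c v m n)
    (fun _ _ _ _ _ => rfl) (fun _ _ _ _ => by positivity) h₅

/-- **(S6) at the residue centres gives (S6) at every centre** (same exponent `δ`). -/
theorem sixthArm_bound_of_residues {k : ℕ} (hk : 0 < k) (γ : unitInterval → ℝ × ℝ) (δ : ℝ)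
    (h₆ : ∀ c₀ : Site 2, (∀ i, 0 ≤ c₀ i ∧ c₀ i < k) → ∃ C₆ : ℝ, ∃ m₀ : ℕ,
      ∀ (s : unitInterval) (m n : ℕ), m₀ ≤ m → m ≤ n →
        (M k (γ s).1 (γ s).2).real (sixArmThreeClustersAt c₀ m n) ≤
          C₆ * ((m : ℝ) / n) ^ δ *
            (M k (γ s).1 (γ s).2).real
              (BondConfig.relabel (sym2Equiv (Site.shift (-c₀))) ⁻¹' zdFiveArmClusters m n)) :
    ∃ C₆ : ℝ, ∃ m₀ : ℕ, ∀ (s : unitInterval) (c : Site 2) (m n : ℕ), m₀ ≤ m → m ≤ n →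
      (M k (γ s).1 (γ s).2).real (sixArmThreeClustersAt c m n) ≤
        C₆ * ((m : ℝ) / n) ^ δ *
          (M k (γ s).1 (γ s).2).real
            (BondConfig.relabel (sym2Equiv (Site.shift (-c))) ⁻¹' zdFiveArmClusters m n) := by
  have h := uniform_of_residues hk
    (fun s c m n => (M k (γ s).1 (γ s).2).real (sixArmThreeClustersAt c m n))
    (fun s c m n => ((m : ℝ) / n) ^ δ * (M k (γ s).1 (γ s).2).real
      (BondConfig.relabel (sym2Equiv (Site.shift (-c))) ⁻¹' zdFiveArmClusters m n))
    (fun s c v m n => M_real_sixArmThreeClustersAt_add_ctr hk.ne' _ _ c v m n)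
    (fun s c v m n => by rw [M_real_preimage_zdFiveArmClusters_add_ctr hk.ne'])
    (fun _ _ m n => mul_nonneg (Real.rpow_nonneg (by positivity) _) measureReal_nonneg)
    (fun c₀ hc₀ => by
      obtain ⟨C₆, m₀, hC⟩ := h₆ c₀ hc₀
      exact ⟨C₆, m₀, fun s m n hm hmn => by rw [← mul_assoc]; exact hC s m n hm hmn⟩)
  obtain ⟨C₆, m₀, hC⟩ := h
  exact ⟨C₆, m₀, fun s c m n hm hmn => by rw [mul_assoc]; exact hC s c m n hm hmn⟩

/-- **Six arms above two along a path, from (S5) and (S6) at the `k²` residue centres** (registered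
helper of the stub `stub_sixArmDecay`): for `k > 0`, if at every residue centre `c₀ ∈ [0,k)²`
(S5) `M_k(γ s)(ω - c₀ ∈ zdFiveArmClusters m n) ≤ C₅(c₀) (m/n)²` and
(S6) `M_k(γ s)(sixArmThreeClustersAt c₀ m n) ≤ C₆(c₀) (m/n)^δ · M_k(γ s)(ω - c₀ ∈ zdFiveArmClusters m n)`
for `m ≥ m₀(c₀)`, `m ≤ n`, uniformly in `s` (one `δ > 0`), then `SixArmDecayAlong k γ`: the
`kℤ²`-invariance of `M_k` spreads the bounds to all centres (`fiveArm_bound_of_residues`,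
`sixthArm_bound_of_residues`) and `sixArmDecayAlong_of_fiveArm` concludes. -/
theorem sixArmDecayAlong_of_fiveArm_residues {k : ℕ} (hk : 0 < k) (γ : unitInterval → ℝ × ℝ)
    (h₅ : ∀ c₀ : Site 2, (∀ i, 0 ≤ c₀ i ∧ c₀ i < k) → ∃ C₅ : ℝ, ∃ m₀ : ℕ,
      ∀ (s : unitInterval) (m n : ℕ), m₀ ≤ m → m ≤ n →
        (M k (γ s).1 (γ s).2).real
            (BondConfig.relabel (sym2Equiv (Site.shift (-c₀))) ⁻¹' zdFiveArmClusters m n) ≤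
          C₅ * ((m : ℝ) / n) ^ 2)
    (h₆ : ∃ δ : ℝ, 0 < δ ∧ ∀ c₀ : Site 2, (∀ i, 0 ≤ c₀ i ∧ c₀ i < k) → ∃ C₆ : ℝ, ∃ m₀ : ℕ,
      ∀ (s : unitInterval) (m n : ℕ), m₀ ≤ m → m ≤ n →
        (M k (γ s).1 (γ s).2).real (sixArmThreeClustersAt c₀ m n) ≤
          C₆ * ((m : ℝ) / n) ^ δ *
            (M k (γ s).1 (γ s).2).real
              (BondConfig.relabel (sym2Equiv (Site.shift (-c₀))) ⁻¹' zdFiveArmClusters m n)) :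
    SixArmDecayAlong k γ := by
  obtain ⟨δ, hδ, h₆⟩ := h₆
  obtain ⟨C₆, m₆, h₆'⟩ := sixthArm_bound_of_residues hk γ δ h₆
  exact sixArmDecayAlong_of_fiveArm k γ (fiveArm_bound_of_residues hk γ h₅) ⟨δ, C₆, hδ, m₆, h₆'⟩

/-! ### Counting over coarse centres -/

-- adapted from Literature/Probability/Percolation/ZdFiveArmCounting.lean (`real_exists_shift_mem_le_card_mul`)
/-- **Union bound over coarse centres** (the counting step of the five-arm construction for `M_k`):
for a finite set `B` of coarse vertices and any event `E`,
`M_k(ρ,c₀)(∃ v ∈ B, ω - k v ∈ E) ≤ |B| · M_k(ρ,c₀)(E)` (`measureReal_biUnion_finset_le` and the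
`kℤ²`-invariance `M_real_preimage_relabel_shift_smul`). -/
theorem M_real_exists_ctr_shift_mem_le_card_mul {k : ℕ} (hk : k ≠ 0) (ρ c₀ : ℝ) (B : Finset (Site 2))
    (E : Set (BondConfig (Site 2))) :
    (M k ρ c₀).real
        {ω | ∃ v ∈ B, BondConfig.relabel (sym2Equiv (Site.shift (-(ctr k v)))) ω ∈ E} ≤
      B.card * (M k ρ c₀).real E := by
  haveI := isProbabilityMeasure_M k ρ c₀
  set μ := M k ρ c₀ with hμ
  have hcover : {ω : BondConfig (Site 2) |
      ∃ v ∈ B, BondConfig.relabel (sym2Equiv (Site.shift (-(ctr k v)))) ω ∈ E} ⊆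
      ⋃ v ∈ B, BondConfig.relabel (sym2Equiv (Site.shift (-(ctr k v)))) ⁻¹' E := by
    intro ω hω
    obtain ⟨v, hv, h⟩ := hω
    exact mem_biUnion (Finset.mem_coe.2 hv) h
  calc μ.real {ω | ∃ v ∈ B, BondConfig.relabel (sym2Equiv (Site.shift (-(ctr k v)))) ω ∈ E}
      ≤ μ.real (⋃ v ∈ B, BondConfig.relabel (sym2Equiv (Site.shift (-(ctr k v)))) ⁻¹' E) :=
        measureReal_mono hcover (measure_ne_top _ _)
    _ ≤ ∑ v ∈ B, μ.real (BondConfig.relabel (sym2Equiv (Site.shift (-(ctr k v)))) ⁻¹' E) :=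
        measureReal_biUnion_finset_le _ _
    _ = ∑ _v ∈ B, μ.real E := Finset.sum_congr rfl fun v _ => by
        rw [hμ, ctr_eq_smul, ← smul_neg]
        exact M_real_preimage_relabel_shift_smul hk ρ c₀ (-v) E
    _ = B.card * μ.real E := by rw [Finset.sum_const, nsmul_eq_mul]

/-- **The counting step of the five-arm UPPER bound** (Kesten–Sidoravicius–Zhang; Nolin 2008,
Thm. 23 (ii): at most one site of the central box is a five-arm site with arms landing in prescribed
sectors, so `N² · π₅' ≤ 1`): under any probability measure, pairwise disjoint measurable events
attached to the sites of a finite set `B`, each of probability at least `p`, force `|B| · p ≤ 1`. -/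
theorem card_mul_le_one_of_pairwiseDisjoint (μ : Measure (BondConfig (Site 2))) [IsProbabilityMeasure μ]
    (B : Finset (Site 2)) (F : Site 2 → Set (BondConfig (Site 2))) (hF : ∀ v ∈ B, MeasurableSet (F v))
    (hdisj : (B : Set (Site 2)).PairwiseDisjoint F) (p : ℝ) (hp : ∀ v ∈ B, p ≤ μ.real (F v)) :
    B.card * p ≤ 1 := by
  calc (B.card : ℝ) * p = ∑ _v ∈ B, p := by rw [Finset.sum_const, nsmul_eq_mul]
    _ ≤ ∑ v ∈ B, μ.real (F v) := Finset.sum_le_sum hp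
    _ = μ.real (⋃ v ∈ B, F v) := (measureReal_biUnion_finset hdisj hF).symm
    _ ≤ 1 := measureReal_le_one

/-! ### Residue centres with a ratio threshold -/

/-- **Bookkeeping with a ratio threshold**: as `uniform_of_residues`, for bounds valid in the range
`m₀ ≤ m`, `A m ≤ n` with a residue-dependent ratio `A ≥ 1` (one threshold `1 + Σ A` serves all). -/
theorem uniform_of_residues_ratio {k : ℕ} (hk : 0 < k) (f g : unitInterval → Site 2 → ℕ → ℕ → ℝ)
    (hf : ∀ s c v m n, f s (c + ctr k v) m n = f s c m n)
    (hg : ∀ s c v m n, g s (c + ctr k v) m n = g s c m n) (hg0 : ∀ s c m n, 0 ≤ g s c m n)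
    (h : ∀ c₀ : Site 2, (∀ i, 0 ≤ c₀ i ∧ c₀ i < k) → ∃ C : ℝ, ∃ m₀ A : ℕ,
      ∀ (s : unitInterval) (m n : ℕ), m₀ ≤ m → A * m ≤ n → f s c₀ m n ≤ C * g s c₀ m n) :
    ∃ C : ℝ, ∃ m₀ A : ℕ, 1 ≤ A ∧ ∀ (s : unitInterval) (c : Site 2) (m n : ℕ), m₀ ≤ m → A * m ≤ n →
      f s c m n ≤ C * g s c m n := by
  classical
  have h' : ∀ c₀ : Site 2, ∃ C : ℝ, ∃ m₀ A : ℕ, (∀ i, 0 ≤ c₀ i ∧ c₀ i < k) →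
      ∀ (s : unitInterval) (m n : ℕ), m₀ ≤ m → A * m ≤ n → f s c₀ m n ≤ C * g s c₀ m n := by
    intro c₀
    by_cases hc₀ : ∀ i, 0 ≤ c₀ i ∧ c₀ i < k
    · obtain ⟨C, m₀, A, hC⟩ := h c₀ hc₀
      exact ⟨C, m₀, A, fun _ => hC⟩
    · exact ⟨0, 0, 0, fun h'' => absurd h'' hc₀⟩
  choose C m₀ A hC using h'
  set R : Finset (Site 2) := Fintype.piFinset (fun _ : Fin 2 => Finset.Ico (0 : ℤ) k) with hR
  refine ⟨∑ c₀ ∈ R, max (C c₀) 0, ∑ c₀ ∈ R, m₀ c₀, 1 + ∑ c₀ ∈ R, A c₀, by omega,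
    fun s c m n hm hmn => ?_⟩
  obtain ⟨c₀, v, hc₀, rfl⟩ := exists_eq_residue_add_ctr hk c
  have hc₀R : c₀ ∈ R := (mem_residues_iff k c₀).2 hc₀
  rw [hf, hg]
  have hm₀ : m₀ c₀ ≤ m := le_trans (Finset.single_le_sum (fun _ _ => Nat.zero_le _) hc₀R) hm
  have hA : A c₀ * m ≤ n := by
    have h1 : A c₀ ≤ ∑ c₁ ∈ R, A c₁ := Finset.single_le_sum (fun _ _ => Nat.zero_le _) hc₀R
    exact le_trans (Nat.mul_le_mul_right m (by omega)) hmn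
  have hCle : max (C c₀) 0 ≤ ∑ c₁ ∈ R, max (C c₁) 0 :=
    Finset.single_le_sum (f := fun c₁ => max (C c₁) 0) (fun _ _ => le_max_right _ _) hc₀R
  calc f s c₀ m n ≤ C c₀ * g s c₀ m n := hC c₀ hc₀ s m n hm₀ hA
    _ ≤ max (C c₀) 0 * g s c₀ m n := mul_le_mul_of_nonneg_right (le_max_left _ _) (hg0 s c₀ m n)
    _ ≤ (∑ c₁ ∈ R, max (C c₁) 0) * g s c₀ m n := mul_le_mul_of_nonneg_right hCle (hg0 s c₀ m n)

/-- **Six arms above two along a path, from a six-arm bound at the `k²` residue centres and large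
ratios only** (registered helper of the stub `stub_sixArmDecay`; the most economical form of its
arm-theoretic input): for `k > 0` and some `ε > 0`, if at every residue centre `c₀ ∈ [0,k)²` there
are `C`, `m₀`, `A` with `M_k(γ s)(sixArmThreeClustersAt c₀ m n) ≤ C (m/n)^{2+ε}` for all `s`, all
`m ≥ m₀` and all `n ≥ A m`, then `SixArmDecayAlong k γ` (`kℤ²`-invariance spreads the bound to all
centres, `uniform_of_residues_ratio`; `sixArmDecayAlong_of_large_scales` removes the thresholds). -/
theorem sixArmDecayAlong_of_residues_large_scales {k : ℕ} (hk : 0 < k) (γ : unitInterval → ℝ × ℝ)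
    (h : ∃ ε : ℝ, 0 < ε ∧ ∀ c₀ : Site 2, (∀ i, 0 ≤ c₀ i ∧ c₀ i < k) → ∃ C : ℝ, ∃ m₀ A : ℕ,
      ∀ (s : unitInterval) (m n : ℕ), m₀ ≤ m → A * m ≤ n →
        (M k (γ s).1 (γ s).2).real (sixArmThreeClustersAt c₀ m n) ≤ C * ((m : ℝ) / n) ^ (2 + ε)) :
    SixArmDecayAlong k γ := by
  obtain ⟨ε, hε, h⟩ := h
  obtain ⟨C, m₀, A, hA, hC⟩ := uniform_of_residues_ratio hk
    (fun s c m n => (M k (γ s).1 (γ s).2).real (sixArmThreeClustersAt c m n))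
    (fun _ _ m n => ((m : ℝ) / n) ^ (2 + ε))
    (fun s c v m n => M_real_sixArmThreeClustersAt_add_ctr hk.ne' _ _ c v m n)
    (fun _ _ _ _ _ => rfl) (fun _ _ m n => Real.rpow_nonneg (by positivity) _) h
  exact sixArmDecayAlong_of_large_scales k γ ⟨ε, C, hε, m₀, A, hA, hC⟩

end Summit.CriticalPhenomena.CardyFormulaZ2.Theorems.CardySelfRefinement.FarField

end
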